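import Mathlib
import Summits.ValiantsHypothesis.ValiantsHypothesis.Theorems.LiouvilleSarnakAlignedTypeICharactersMod2nBilinearSieveCounting
import HarnessLib

/-!
# Route LiouvilleSarnak — support `AlignedTypeI` (stmt-ValiantsHypothesis-21040), line `characters_mod_2n`:
# the bilinear (Turán–Kubilius × large-sieve) inequality for the character mean square

THE REDUCTION (finitary, explicit, general modulus `q`).  Let `𝒫` be a finite set of primes `p ≤ x`, grouped into blocks
by a map `V` (`p ≤ V(p) ≤ x`, the block of `p` is the fibre of `V`; think `V(p) = ⌈p⌉_{(1+δ)-adic}`) which are SHORT in the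
sense `x·V(p) ≤ x·p + ℓ·V(p)` (`V(p)/p ≤ x/(x−ℓ)`, think `ℓ = δx`), and suppose every non-principal character `ψ (mod q)`
has `|Σ_{p ∈ 𝒫, V(p) = v} ψ(p)| ≤ β_v` on every block.  Then, with `L = Σ_{p ∈ 𝒫} 1/p`, `R = Σ_v β_v/v`, `R' = Σ_v β_v`:

`L² · Σ_{ψ ≠ 1} |Σ_{m ≤ x} λ(m) ψ(m)|² ≤ 3 · ( xR (xR + 2qR') + (ℓ + 2q)(ℓL² + ℓL + |𝒫|²) + (x + 2q) T )`

(`charSqSum_mul_sq_le_of_blockBounds`; `T ≥ Σ_{m ≤ x} (ω_𝒫(m) − L)²` is a parameter — Turán–Kubilius gives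
`T = 278·x·L`, plugged in by the companion file `…BilinearSieveTK.lean`).  Read with `q ≤ √x`, `ℓ = δx`, blocks `(1+δ)`-adic in `(P₁, Q₁]`, `Q₁ ≤ √x`,
`β_v = η · #block`: the right side is `≪ (η²/δ² + δ² + 1/L) x² L²`, i.e. `Σ_{ψ≠1}|Σ λψ|² = o(x²)` once `L → ∞` (Mertens),
`δ → 0` and the prime sums save `η = o(δ)` — for `q = 2^k` the Postnikov–Gallagher / Banks–Shparlinski range. Fed into
`alignedTypeI_of_charMeanSquare` (`…Parseval.lean`, with `χ₁ = 1`) this replaces the XL residual of the leaf (KMT 2023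
Thm 1.3) by PRIME character sums to `2`-power moduli at length `q^{o(1)}` — a classical input.

Proof (Turán–Kubilius × large sieve; the only arithmetic of `λ` used is `λ(pr) = −λ(r)`):
`L·S(ψ) = Σ_m λψ·ω − Σ_m λψ·(ω − L)`; the second piece has `Σ_ψ |·|² ≤ (x+2q)·T` (large sieve for one modulus ×
the Turán–Kubilius variance `T`); the first is `−Σ_p ψ(p) A_ψ(x/p)` (`A_ψ(y) = Σ_{r ≤ y} λψ(r)`), and `A_ψ(x/p) = A_ψ(x/V(p)) + (tail over
x/V(p) < r ≤ x/p)`; the tails recombine into `Σ_{x−ℓ < m ≤ x} e_m ψ(m)` with `|e_m| ≤ ω(m)` (large sieve on a SHORT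
interval: `(ℓ+2q)(ℓL² + ℓL + |𝒫|²)`), and the heads are `Σ_v B_v(ψ) A_ψ(x/v)` with `|B_v(ψ)| ≤ β_v`, handled by a weighted
Cauchy–Schwarz and the large sieve at each length `x/v` (`xR(xR + 2qR')`).

HONEST FRAMING. An unconditional inequality; it closes nothing by itself (the block bounds `β` are its input).
`AlignedTypeI` is NOT closed here; nothing bears on `VP ≠ VNP` (NOT proved).
-/

set_option linter.dupNamespace false

noncomputable section

namespace Summit.ValiantsHypothesis.ValiantsHypothesis.Theorems.LiouvilleSarnak.AlignedTypeI.CharactersModTwoN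

open ArithmeticFunction Finset
open scoped BigOperators

/-! ## §1 The main inequality -/

/-- **The bilinear inequality for the character mean square** (see the module docstring).  For a finite set `𝒫` of primes,
a block map `V` with `p ≤ V p ≤ x` and `x·V(p) ≤ x·p + ℓ·V(p)` (`ℓ ≤ x`), nonnegative block bounds `β` with
`|Σ_{p ∈ 𝒫, V p = v} ψ(p)| ≤ β_v` for every `ψ ≠ 1 (mod q)` and every block value `v`, and
`L = Σ_{p ∈ 𝒫} 1/p`, `R = Σ_{v ∈ V(𝒫)} β_v/v`, `R' = Σ_{v ∈ V(𝒫)} β_v`, and any `T ≥ Σ_{m ≤ x} (ω_𝒫(m) − L)²`: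
`L² Σ_{ψ ≠ 1} |Σ_{m ≤ x} λ(m)ψ(m)|² ≤ 3 (xR(xR + 2qR') + (ℓ + 2q)(ℓL² + ℓL + |𝒫|²) + (x + 2q) T)`. [folklore] -/
theorem charSqSum_mul_sq_le_of_blockBounds {q : ℕ} [NeZero q] (x ℓ : ℕ) (hℓx : ℓ ≤ x)
    (P : Finset ℕ) (hP : ∀ p ∈ P, p.Prime)
    (V : ℕ → ℕ) (hV : ∀ p ∈ P, p ≤ V p) (hVx : ∀ p ∈ P, V p ≤ x) (hVℓ : ∀ p ∈ P, x * V p ≤ x * p + ℓ * V p)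
    (β : ℕ → ℝ) (hβ0 : ∀ v, 0 ≤ β v)
    (hβ : ∀ ψ : DirichletCharacter ℂ q, ψ ≠ 1 → ∀ v ∈ P.image V,
      ‖∑ p ∈ P.filter (fun p => V p = v), ψ (p : ZMod q)‖ ≤ β v)
    (T : ℝ) (hT : ∑ m ∈ Finset.Icc 1 x,
      ((((P.filter (fun p => p ∣ m)).card : ℝ)) - ∑ p ∈ P, (1 : ℝ) / p) ^ 2 ≤ T) :
    (∑ p ∈ P, (1 : ℝ) / p) ^ 2 *
        ∑ ψ ∈ (Finset.univ : Finset (DirichletCharacter ℂ q)).erase 1,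
          ‖∑ m ∈ Finset.Icc 1 x, (liouville m : ℂ) * ψ (m : ZMod q)‖ ^ 2 ≤
      3 * ((x : ℝ) * (∑ v ∈ P.image V, β v / v) *
              ((x : ℝ) * (∑ v ∈ P.image V, β v / v) + 2 * q * ∑ v ∈ P.image V, β v) +
            ((ℓ : ℝ) + 2 * q) * ((ℓ : ℝ) * (∑ p ∈ P, (1 : ℝ) / p) ^ 2 + (ℓ : ℝ) * (∑ p ∈ P, (1 : ℝ) / p)
              + (P.card : ℝ) ^ 2) +
            ((x : ℝ) + 2 * q) * T) := by
  classical
  have hq : 0 < q := Nat.pos_of_ne_zero (NeZero.ne q)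
  -- notation
  set L : ℝ := ∑ p ∈ P, (1 : ℝ) / p with hL
  set R : ℝ := ∑ v ∈ P.image V, β v / v with hR
  set R' : ℝ := ∑ v ∈ P.image V, β v with hR'
  set ω : ℕ → ℝ := fun m => ((P.filter (fun p => p ∣ m)).card : ℝ) with hω
  set S : DirichletCharacter ℂ q → ℂ := fun ψ => ∑ m ∈ Finset.Icc 1 x, (liouville m : ℂ) * ψ (m : ZMod q) with hS
  set A : DirichletCharacter ℂ q → ℕ → ℂ := fun ψ y => ∑ r ∈ Finset.Ioc 0 y, (liouville r : ℂ) * ψ (r : ZMod q)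
    with hA
  set E : DirichletCharacter ℂ q → ℂ := fun ψ =>
    ∑ m ∈ Finset.Icc 1 x, ((liouville m : ℂ) * ((ω m - L : ℝ) : ℂ)) * ψ (m : ZMod q) with hE
  set T₁ : DirichletCharacter ℂ q → ℂ := fun ψ =>
    ∑ v ∈ P.image V, (∑ p ∈ P.filter (fun p => V p = v), ψ (p : ZMod q)) * A ψ (x / v) with hT₁
  set e : ℕ → ℂ := fun m =>
    ∑ p ∈ P.filter (fun p => p ∣ m), (if x / V p < m / p then (liouville (m / p) : ℂ) else 0) with he
  set T₂ : DirichletCharacter ℂ q → ℂ := fun ψ => ∑ m ∈ Finset.Ioc (x - ℓ) x, e m * ψ (m : ZMod q) with hT₂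
  have hL0 : 0 ≤ L := Finset.sum_nonneg fun p _ => by positivity
  have hP0 : ∀ p ∈ P, 0 < p := fun p hp => (hP p hp).pos
  have hV0 : ∀ p ∈ P, 0 < V p := fun p hp => lt_of_lt_of_le (hP0 p hp) (hV p hp)
  have hxR : (0 : ℝ) ≤ x := Nat.cast_nonneg _
  have hIcc : ∀ y : ℕ, Finset.Icc 1 y = Finset.Ioc 0 y := by
    intro y
    ext m
    simp only [Finset.mem_Icc, Finset.mem_Ioc]
    omega
  have hlam1 : ∀ n : ℕ, ‖((liouville n : ℤ) : ℂ)‖ ≤ 1 := fun n =>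
    (sq_le_one_iff₀ (norm_nonneg _)).mp (norm_sq_liouville_intCast_le_one n)
  -- Step 1: `L · S ψ = W ψ − E ψ` with `W ψ = Σ_m λψ(m) ω(m) = −Σ_p ψ(p) A ψ (x/p)`
  have hW : ∀ ψ : DirichletCharacter ℂ q,
      ∑ m ∈ Finset.Icc 1 x, ((liouville m : ℂ) * ((ω m : ℝ) : ℂ)) * ψ (m : ZMod q) =
        -∑ p ∈ P, ψ (p : ZMod q) * A ψ (x / p) := by
    intro ψ
    have h1 : ∀ m, ((liouville m : ℂ) * ((ω m : ℝ) : ℂ)) * ψ (m : ZMod q) =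
        ∑ p ∈ P.filter (fun p => p ∣ m), (liouville m : ℂ) * ψ (m : ZMod q) := by
      intro m
      rw [Finset.sum_const, nsmul_eq_mul, hω]
      push_cast
      ring
    simp_rw [h1]
    rw [sum_Icc_sum_filter_dvd_eq P hP0 x (fun _ m => (liouville m : ℂ) * ψ (m : ZMod q))]
    rw [← Finset.sum_neg_distrib]
    refine Finset.sum_congr rfl fun p hp => ?_
    rw [hA]
    simp only
    rw [Finset.mul_sum, ← Finset.sum_neg_distrib, ← hIcc]
    refine Finset.sum_congr rfl fun r _ => ?_
    rw [liouville_apply_mul, liouville_apply (hP p hp).ne_zero, cardFactors_apply_prime (hP p hp), pow_one,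
      Nat.cast_mul, map_mul]
    push_cast
    ring
  have hsplit : ∀ ψ : DirichletCharacter ℂ q, (L : ℂ) * S ψ =
      ∑ m ∈ Finset.Icc 1 x, ((liouville m : ℂ) * ((ω m : ℝ) : ℂ)) * ψ (m : ZMod q) - E ψ := by
    intro ψ
    rw [hS, hE]
    simp only
    rw [Finset.mul_sum, ← Finset.sum_sub_distrib]
    refine Finset.sum_congr rfl fun m _ => ?_
    push_cast
    ring
  -- Step 2: `Σ_p ψ(p) A ψ (x/p) = T₁ ψ + T₂ ψ`
  have hAsplit : ∀ ψ : DirichletCharacter ℂ q, ∀ p ∈ P,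
      A ψ (x / p) = A ψ (x / V p) + ∑ r ∈ Finset.Ioc (x / V p) (x / p), (liouville r : ℂ) * ψ (r : ZMod q) := by
    intro ψ p hp
    rw [hA]
    simp only
    have hle : x / V p ≤ x / p := Nat.div_le_div_left (hV p hp) (hP0 p hp)
    rw [← Finset.Ioc_union_Ioc_eq_Ioc (Nat.zero_le _) hle,
      Finset.sum_union (Finset.Ioc_disjoint_Ioc_of_le le_rfl)]
  have hT₁eq : ∀ ψ : DirichletCharacter ℂ q,
      ∑ p ∈ P, ψ (p : ZMod q) * A ψ (x / V p) = T₁ ψ := by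
    intro ψ
    rw [hT₁]
    simp only
    rw [← Finset.sum_fiberwise_of_maps_to (s := P) (t := P.image V) (g := V)
      (fun p hp => Finset.mem_image_of_mem V hp)]
    refine Finset.sum_congr rfl fun v _ => ?_
    rw [Finset.sum_mul]
    refine Finset.sum_congr rfl fun p hp => ?_
    rw [(Finset.mem_filter.mp hp).2]
  have hT₂full : ∀ ψ : DirichletCharacter ℂ q,
      ∑ p ∈ P, ψ (p : ZMod q) * ∑ r ∈ Finset.Ioc (x / V p) (x / p), (liouville r : ℂ) * ψ (r : ZMod q) =
        ∑ m ∈ Finset.Icc 1 x, e m * ψ (m : ZMod q) := by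
    intro ψ
    have h1 : ∀ m, e m * ψ (m : ZMod q) =
        ∑ p ∈ P.filter (fun p => p ∣ m),
          (if x / V p < m / p then (liouville (m / p) : ℂ) else 0) * ψ (m : ZMod q) := by
      intro m
      rw [he, Finset.sum_mul]
    simp_rw [h1]
    rw [sum_Icc_sum_filter_dvd_eq P hP0 x
      (fun p m => (if x / V p < m / p then (liouville (m / p) : ℂ) else 0) * ψ (m : ZMod q))]
    refine Finset.sum_congr rfl fun p hp => ?_
    have hp0 := hP0 p hp
    rw [Finset.mul_sum]
    have hIoc : Finset.Ioc (x / V p) (x / p) = (Finset.Icc 1 (x / p)).filter (fun r => x / V p < r) := by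
      ext r
      simp only [Finset.mem_Ioc, Finset.mem_filter, Finset.mem_Icc]
      generalize x / V p = y
      generalize x / p = z
      omega
    rw [hIoc, Finset.sum_filter]
    refine Finset.sum_congr rfl fun r _ => ?_
    rw [Nat.mul_div_cancel_left r hp0]
    split_ifs with h
    · rw [Nat.cast_mul, map_mul]
      ring
    · simp
  have hesupp : ∀ m ∈ Finset.Icc 1 x, m ∉ Finset.Ioc (x - ℓ) x → e m * (0 : ℂ) = 0 ∧ e m = 0 := by
    intro m hm hm'
    refine ⟨mul_zero _, ?_⟩
    rw [Finset.mem_Icc] at hm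
    rw [Finset.mem_Ioc, not_and_or, not_lt] at hm'
    have hmle : m ≤ x - ℓ := by omega
    rw [he]
    refine Finset.sum_eq_zero fun p hp => ?_
    rw [Finset.mem_filter] at hp
    have hpP := hp.1
    have hp0 := hP0 p hpP
    rw [if_neg]
    rw [not_lt]
    -- `m / p ≤ (x - ℓ) / p ≤ x / V p`
    refine le_trans (Nat.div_le_div_right hmle) ?_
    refine (Nat.le_div_iff_mul_le (hV0 p hpP)).mpr ?_
    have h1 : (x - ℓ) / p * V p * p ≤ x * p := by
      calc (x - ℓ) / p * V p * p = (x - ℓ) / p * p * V p := by ring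
        _ ≤ (x - ℓ) * V p := Nat.mul_le_mul_right _ (Nat.div_mul_le_self _ _)
        _ = x * V p - ℓ * V p := by rw [Nat.sub_mul]
        _ ≤ x * p := Nat.sub_le_iff_le_add.mpr (hVℓ p hpP)
    exact Nat.le_of_mul_le_mul_right h1 hp0
  have hT₂eq : ∀ ψ : DirichletCharacter ℂ q,
      ∑ m ∈ Finset.Icc 1 x, e m * ψ (m : ZMod q) = T₂ ψ := by
    intro ψ
    rw [hT₂]
    simp only
    symm
    refine Finset.sum_subset (fun m hm => ?_) (fun m hm hm' => ?_)
    · rw [Finset.mem_Ioc] at hm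
      rw [Finset.mem_Icc]
      omega
    · rw [(hesupp m hm hm').2, zero_mul]
  have hdecomp : ∀ ψ : DirichletCharacter ℂ q, (L : ℂ) * S ψ = -T₁ ψ - T₂ ψ - E ψ := by
    intro ψ
    have h3 : ∑ p ∈ P, ψ (p : ZMod q) * A ψ (x / p) =
        ∑ p ∈ P, (ψ (p : ZMod q) * A ψ (x / V p) +
          ψ (p : ZMod q) * ∑ r ∈ Finset.Ioc (x / V p) (x / p), (liouville r : ℂ) * ψ (r : ZMod q)) :=
      Finset.sum_congr rfl fun p hp => by rw [hAsplit ψ p hp, mul_add]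
    rw [hsplit ψ, hW ψ, h3, Finset.sum_add_distrib, hT₁eq ψ, hT₂full ψ, hT₂eq ψ]
    ring
  -- Step 3: the three mean squares
  -- (E) the variance `T` × large sieve
  have hT0 : 0 ≤ T := le_trans (Finset.sum_nonneg fun m _ => sq_nonneg _) hT
  have hEbound : ∑ ψ : DirichletCharacter ℂ q, ‖E ψ‖ ^ 2 ≤ ((x : ℝ) + 2 * q) * T := by
    have hls := largeSieve_Ioc (q := q) 0 x (Nat.zero_le x) (fun m => (liouville m : ℂ) * ((ω m - L : ℝ) : ℂ))
    rw [← hIcc] at hls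
    have hE' : ∀ ψ, E ψ = ∑ m ∈ Finset.Icc 1 x, ((liouville m : ℂ) * ((ω m - L : ℝ) : ℂ)) * ψ (m : ZMod q) :=
      fun ψ => rfl
    simp_rw [hE']
    refine hls.trans ?_
    have hcoef : ∑ m ∈ Finset.Icc 1 x, ‖(liouville m : ℂ) * ((ω m - L : ℝ) : ℂ)‖ ^ 2 ≤ T := by
      refine le_trans (Finset.sum_le_sum fun m _ => ?_) hT
      rw [norm_mul, mul_pow, Complex.norm_real, Real.norm_eq_abs, sq_abs]
      have h1 : ‖(liouville m : ℂ)‖ ^ 2 ≤ 1 := norm_sq_liouville_intCast_le_one m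
      have h2 : 0 ≤ (ω m - L) ^ 2 := sq_nonneg _
      nlinarith
    have hx2q : 0 ≤ ((x : ℝ) - ((0 : ℕ) : ℝ)) + 2 * q := by rw [Nat.cast_zero, sub_zero]; positivity
    calc (((x : ℝ) - ((0 : ℕ) : ℝ)) + 2 * q) * ∑ m ∈ Finset.Icc 1 x, ‖(liouville m : ℂ) * ((ω m - L : ℝ) : ℂ)‖ ^ 2
        ≤ (((x : ℝ) - ((0 : ℕ) : ℝ)) + 2 * q) * T := mul_le_mul_of_nonneg_left hcoef hx2q
      _ = ((x : ℝ) + 2 * q) * T := by push_cast; ring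
  -- (T₂) large sieve on the short interval × second moment of ω
  have hT₂bound : ∑ ψ : DirichletCharacter ℂ q, ‖T₂ ψ‖ ^ 2 ≤
      ((ℓ : ℝ) + 2 * q) * ((ℓ : ℝ) * L ^ 2 + (ℓ : ℝ) * L + (P.card : ℝ) ^ 2) := by
    have hxl : x - ℓ ≤ x := Nat.sub_le x ℓ
    have hls := largeSieve_Ioc (q := q) (x - ℓ) x hxl e
    have hT' : ∀ ψ, T₂ ψ = ∑ m ∈ Finset.Ioc (x - ℓ) x, e m * ψ (m : ZMod q) := fun ψ => rfl
    simp_rw [hT']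
    refine hls.trans ?_
    have hlen : ((x : ℝ) - ((x - ℓ : ℕ) : ℝ)) = ℓ := by
      rw [Nat.cast_sub hℓx]
      ring
    rw [hlen]
    have hω2 := sum_Ioc_card_filter_dvd_sq_le P hP hxl
    rw [hlen] at hω2
    have hcoef : ∑ m ∈ Finset.Ioc (x - ℓ) x, ‖e m‖ ^ 2 ≤ (ℓ : ℝ) * L ^ 2 + (ℓ : ℝ) * L + (P.card : ℝ) ^ 2 := by
      refine le_trans (Finset.sum_le_sum fun m _ => ?_) hω2
      have hem : ‖e m‖ ≤ ω m := by
        rw [he, hω]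
        simp only
        refine (norm_sum_le _ _).trans ?_
        rw [Finset.card_eq_sum_ones, Nat.cast_sum]
        push_cast
        refine Finset.sum_le_sum fun p _ => ?_
        split_ifs
        · exact hlam1 _
        · simp
      have h0 : 0 ≤ ‖e m‖ := norm_nonneg _
      nlinarith
    have hl2q : 0 ≤ (ℓ : ℝ) + 2 * q := by positivity
    exact mul_le_mul_of_nonneg_left hcoef hl2q
  -- (T₁) weighted Cauchy–Schwarz × large sieve at each length `x / v`
  have hAbound : ∀ y : ℕ, ∑ ψ : DirichletCharacter ℂ q, ‖A ψ y‖ ^ 2 ≤ ((y : ℝ) + 2 * q) * y :=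
    fun y => sum_char_norm_sq_liouville_le (q := q) y
  have hv0 : ∀ v ∈ P.image V, (0 : ℝ) < v := by
    intro v hv
    obtain ⟨p, hp, rfl⟩ := Finset.mem_image.mp hv
    exact_mod_cast hV0 p hp
  have hvx : ∀ v ∈ P.image V, (v : ℝ) ≤ x := by
    intro v hv
    obtain ⟨p, hp, rfl⟩ := Finset.mem_image.mp hv
    exact_mod_cast hVx p hp
  -- pointwise: `‖T₁ ψ‖² ≤ (x R) · Σ_v β_v (v/x) ‖A ψ (x/v)‖²` for `ψ ≠ 1`
  have hT₁pt : ∀ ψ : DirichletCharacter ℂ q, ψ ≠ 1 →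
      ‖T₁ ψ‖ ^ 2 ≤ ((x : ℝ) * R) * ∑ v ∈ P.image V, β v * ((v : ℝ) / x) * ‖A ψ (x / v)‖ ^ 2 := by
    intro ψ hψ
    have h1 : ‖T₁ ψ‖ ≤ ∑ v ∈ P.image V, β v * ‖A ψ (x / v)‖ := by
      rw [hT₁]
      refine (norm_sum_le _ _).trans (Finset.sum_le_sum fun v hv => ?_)
      rw [norm_mul]
      exact mul_le_mul_of_nonneg_right (hβ ψ hψ v hv) (norm_nonneg _)
    have h0 : 0 ≤ ‖T₁ ψ‖ := norm_nonneg _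
    -- Cauchy–Schwarz with `f_v = √(β_v x/v)`, `g_v = √(β_v v/x) ‖A‖`
    have hCS := Finset.sum_mul_sq_le_sq_mul_sq (P.image V)
      (fun v => Real.sqrt (β v * ((x : ℝ) / v))) (fun v => Real.sqrt (β v * ((v : ℝ) / x)) * ‖A ψ (x / v)‖)
    have hfg : ∀ v ∈ P.image V,
        Real.sqrt (β v * ((x : ℝ) / v)) * (Real.sqrt (β v * ((v : ℝ) / x)) * ‖A ψ (x / v)‖) =
          β v * ‖A ψ (x / v)‖ := by
      intro v hv
      have hv := hv0 v hv
      rw [← mul_assoc, ← Real.sqrt_mul (by have := hβ0 v; positivity)]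
      rcases eq_or_lt_of_le hxR with hx0 | hx0
      · -- `x = 0` is impossible here (`v ≤ x`, `0 < v`), but handle it uniformly
        have : (v : ℝ) ≤ x := hvx v ‹_›
        linarith
      · have hxv : (x : ℝ) / v * ((v : ℝ) / x) = 1 := by
          rw [div_mul_div_comm, mul_comm, div_self]
          exact mul_ne_zero hv.ne' hx0.ne'
        have : β v * ((x : ℝ) / v) * (β v * ((v : ℝ) / x)) = β v ^ 2 := by
          calc β v * ((x : ℝ) / v) * (β v * ((v : ℝ) / x)) = β v ^ 2 * ((x : ℝ) / v * ((v : ℝ) / x)) := by ring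
            _ = β v ^ 2 := by rw [hxv, mul_one]
        rw [this, Real.sqrt_sq (hβ0 v)]
    have hff : ∀ v ∈ P.image V, Real.sqrt (β v * ((x : ℝ) / v)) ^ 2 = β v * ((x : ℝ) / v) := by
      intro v hv
      exact Real.sq_sqrt (by have := hβ0 v; have := hv0 v hv; positivity)
    have hgg : ∀ v ∈ P.image V,
        (Real.sqrt (β v * ((v : ℝ) / x)) * ‖A ψ (x / v)‖) ^ 2 = β v * ((v : ℝ) / x) * ‖A ψ (x / v)‖ ^ 2 := by
      intro v hv
      rw [mul_pow, Real.sq_sqrt (by have := hβ0 v; have := hv0 v hv; positivity)]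
    rw [Finset.sum_congr rfl hfg, Finset.sum_congr rfl hff, Finset.sum_congr rfl hgg] at hCS
    have hxR' : ∑ v ∈ P.image V, β v * ((x : ℝ) / v) = (x : ℝ) * R := by
      rw [hR, Finset.mul_sum]
      refine Finset.sum_congr rfl fun v _ => ?_
      ring
    rw [hxR'] at hCS
    calc ‖T₁ ψ‖ ^ 2 ≤ (∑ v ∈ P.image V, β v * ‖A ψ (x / v)‖) ^ 2 := by gcongr
      _ ≤ _ := hCS
  have hT₁bound : ∑ ψ ∈ (Finset.univ : Finset (DirichletCharacter ℂ q)).erase 1, ‖T₁ ψ‖ ^ 2 ≤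
      (x : ℝ) * R * ((x : ℝ) * R + 2 * q * R') := by
    have hR0 : 0 ≤ R := Finset.sum_nonneg fun v hv => by have := hβ0 v; have := hv0 v hv; positivity
    calc ∑ ψ ∈ (Finset.univ : Finset (DirichletCharacter ℂ q)).erase 1, ‖T₁ ψ‖ ^ 2
        ≤ ∑ ψ ∈ (Finset.univ : Finset (DirichletCharacter ℂ q)).erase 1,
            ((x : ℝ) * R) * ∑ v ∈ P.image V, β v * ((v : ℝ) / x) * ‖A ψ (x / v)‖ ^ 2 :=
          Finset.sum_le_sum fun ψ hψ => hT₁pt ψ (Finset.ne_of_mem_erase hψ)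
      _ = ((x : ℝ) * R) * ∑ v ∈ P.image V, β v * ((v : ℝ) / x) *
            ∑ ψ ∈ (Finset.univ : Finset (DirichletCharacter ℂ q)).erase 1, ‖A ψ (x / v)‖ ^ 2 := by
          rw [← Finset.mul_sum, Finset.sum_comm]
          congr 1
          refine Finset.sum_congr rfl fun v _ => ?_
          rw [Finset.mul_sum]
      _ ≤ ((x : ℝ) * R) * ∑ v ∈ P.image V, β v * ((v : ℝ) / x) * ((((x / v : ℕ) : ℝ) + 2 * q) * ((x / v : ℕ) : ℝ)) := by
          gcongr with v hv
          · exact mul_nonneg (hβ0 v) (by have := hv0 v hv; positivity)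
          · calc ∑ ψ ∈ (Finset.univ : Finset (DirichletCharacter ℂ q)).erase 1, ‖A ψ (x / v)‖ ^ 2
                ≤ ∑ ψ : DirichletCharacter ℂ q, ‖A ψ (x / v)‖ ^ 2 :=
                  Finset.sum_le_univ_sum_of_nonneg fun ψ => by positivity
              _ ≤ _ := hAbound (x / v)
      _ ≤ ((x : ℝ) * R) * ∑ v ∈ P.image V, β v * ((x : ℝ) / v + 2 * q) := by
          refine mul_le_mul_of_nonneg_left (Finset.sum_le_sum fun v hv => ?_) (by positivity)
          have hv' := hv0 v hv
          have hb := hβ0 v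
          have hdiv : ((x / v : ℕ) : ℝ) ≤ (x : ℝ) / v := Nat.cast_div_le
          have hdiv0 : (0 : ℝ) ≤ ((x / v : ℕ) : ℝ) := Nat.cast_nonneg _
          rcases eq_or_lt_of_le hxR with hx0 | hx0
          · have : (v : ℝ) ≤ x := hvx v hv
            linarith
          · have hxv : (v : ℝ) / x * ((x : ℝ) / v) = 1 := by
              rw [div_mul_div_comm, mul_comm, div_self]
              exact mul_ne_zero hx0.ne' hv'.ne'
            calc β v * ((v : ℝ) / x) * ((((x / v : ℕ) : ℝ) + 2 * q) * ((x / v : ℕ) : ℝ))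
                ≤ β v * ((v : ℝ) / x) * (((x : ℝ) / v + 2 * q) * ((x : ℝ) / v)) := by gcongr
              _ = β v * ((x : ℝ) / v + 2 * q) * ((v : ℝ) / x * ((x : ℝ) / v)) := by ring
              _ = β v * ((x : ℝ) / v + 2 * q) := by rw [hxv, mul_one]
      _ = (x : ℝ) * R * ((x : ℝ) * R + 2 * q * R') := by
          congr 1
          rw [hR, hR', Finset.mul_sum, Finset.mul_sum, ← Finset.sum_add_distrib]
          refine Finset.sum_congr rfl fun v _ => ?_
          ring
  -- Step 4: combine
  have hpt : ∀ ψ : DirichletCharacter ℂ q,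
      L ^ 2 * ‖S ψ‖ ^ 2 ≤ 3 * (‖T₁ ψ‖ ^ 2 + ‖T₂ ψ‖ ^ 2 + ‖E ψ‖ ^ 2) := by
    intro ψ
    have h1 : L ^ 2 * ‖S ψ‖ ^ 2 = ‖(L : ℂ) * S ψ‖ ^ 2 := by
      rw [norm_mul, Complex.norm_real, Real.norm_eq_abs, abs_of_nonneg hL0, mul_pow]
    rw [h1, hdecomp ψ]
    have h2 : ‖-T₁ ψ - T₂ ψ - E ψ‖ ≤ ‖T₁ ψ‖ + ‖T₂ ψ‖ + ‖E ψ‖ := by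
      calc ‖-T₁ ψ - T₂ ψ - E ψ‖ ≤ ‖-T₁ ψ - T₂ ψ‖ + ‖E ψ‖ := norm_sub_le _ _
        _ ≤ ‖-T₁ ψ‖ + ‖T₂ ψ‖ + ‖E ψ‖ := by gcongr; exact norm_sub_le _ _
        _ = ‖T₁ ψ‖ + ‖T₂ ψ‖ + ‖E ψ‖ := by rw [norm_neg]
    have h0 : 0 ≤ ‖-T₁ ψ - T₂ ψ - E ψ‖ := norm_nonneg _
    have ha : 0 ≤ ‖T₁ ψ‖ := norm_nonneg _
    have hb : 0 ≤ ‖T₂ ψ‖ := norm_nonneg _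
    have hc : 0 ≤ ‖E ψ‖ := norm_nonneg _
    nlinarith [sq_nonneg (‖T₁ ψ‖ - ‖T₂ ψ‖), sq_nonneg (‖T₂ ψ‖ - ‖E ψ‖), sq_nonneg (‖T₁ ψ‖ - ‖E ψ‖)]
  simp_rw [show ∀ ψ, (∑ m ∈ Finset.Icc 1 x, (liouville m : ℂ) * ψ (m : ZMod q)) = S ψ from fun ψ => rfl]
  have hT₂' : ∑ ψ ∈ (Finset.univ : Finset (DirichletCharacter ℂ q)).erase 1, ‖T₂ ψ‖ ^ 2 ≤
      ((ℓ : ℝ) + 2 * q) * ((ℓ : ℝ) * L ^ 2 + (ℓ : ℝ) * L + (P.card : ℝ) ^ 2) :=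
    (Finset.sum_le_univ_sum_of_nonneg fun ψ => by positivity).trans hT₂bound
  have hE' : ∑ ψ ∈ (Finset.univ : Finset (DirichletCharacter ℂ q)).erase 1, ‖E ψ‖ ^ 2 ≤
      ((x : ℝ) + 2 * q) * T :=
    (Finset.sum_le_univ_sum_of_nonneg fun ψ => by positivity).trans hEbound
  calc L ^ 2 * ∑ ψ ∈ (Finset.univ : Finset (DirichletCharacter ℂ q)).erase 1, ‖S ψ‖ ^ 2
      = ∑ ψ ∈ (Finset.univ : Finset (DirichletCharacter ℂ q)).erase 1, L ^ 2 * ‖S ψ‖ ^ 2 := by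
        rw [Finset.mul_sum]
    _ ≤ ∑ ψ ∈ (Finset.univ : Finset (DirichletCharacter ℂ q)).erase 1,
          3 * (‖T₁ ψ‖ ^ 2 + ‖T₂ ψ‖ ^ 2 + ‖E ψ‖ ^ 2) := Finset.sum_le_sum fun ψ _ => hpt ψ
    _ = 3 * (∑ ψ ∈ (Finset.univ : Finset (DirichletCharacter ℂ q)).erase 1, ‖T₁ ψ‖ ^ 2 +
          ∑ ψ ∈ (Finset.univ : Finset (DirichletCharacter ℂ q)).erase 1, ‖T₂ ψ‖ ^ 2 +
          ∑ ψ ∈ (Finset.univ : Finset (DirichletCharacter ℂ q)).erase 1, ‖E ψ‖ ^ 2) := by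
        rw [← Finset.mul_sum, Finset.sum_add_distrib, Finset.sum_add_distrib]
    _ ≤ 3 * ((x : ℝ) * R * ((x : ℝ) * R + 2 * q * R') +
          ((ℓ : ℝ) + 2 * q) * ((ℓ : ℝ) * L ^ 2 + (ℓ : ℝ) * L + (P.card : ℝ) ^ 2) +
          ((x : ℝ) + 2 * q) * T) := by
        linarith [hT₁bound, hT₂', hE']

end Summit.ValiantsHypothesis.ValiantsHypothesis.Theorems.LiouvilleSarnak.AlignedTypeI.CharactersModTwoN
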